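import Literature.NumberTheory.LFunctions.KloostermanFractionsDiagonal
import HarnessLib

/-!
# Bilinear forms with Kloosterman fractions: the degenerate off-diagonal tuples, trivially

Topic `NumberTheory/LFunctions`.  In the off-diagonal terms
`𝓞_b = ∑_{m} ∑_{ℓ₁,ℓ₂∈𝓛, n₁,n₂, ℓ₁n₁≠ℓ₂n₂} [(ℓ₂n₂,m)=1, ℓ₁n₁≡ℓ₂n₂ (m)] c_m(n₁) conj c_m(n₂)`,
`c_m(n) = γ_n e(k m̄/(bn))`, of the amplified second moment (Bettin–Chandee, *Trilinear forms with
Kloosterman fractions*, Adv. Math. 328 (2018), §2 (def:DbEb), §4; Duke–Friedlander–Iwaniec,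
Invent. Math. 128 (1997)), the tuples with `ℓ₁ = ℓ₂` or `(n₁n₂, ℓ₁ℓ₂) > 1` are "degenerate":
the source carries them through the whole Kloosterman-sum analysis of §4 by means of the
parameters `𝔭₁ = (ℓ₁,n₁), 𝔭₂ = (ℓ₂,n₁), 𝔮₁ = (ℓ₁,n₂), 𝔮₂ = (ℓ₂,n₂)` (vae1) and `η` (for
`(ℓ₁,ℓ₂) > 1`, (dft)).  For the case `A = 1` needed for DFI's theorem they can instead be bounded
TRIVIALLY, at the cost `≪ L N'^{1+ε} ‖γ‖²` — the same order as the "longer diagonal" the source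
keeps anyway ((eqn:diagonal): `𝓓_b ≪ … + LM …`, and the term `AL²N²` of (2bd)).  This file PROVES
that trivial bound with explicit constants (`kfo_deg_bound`): for ANY finite set `S` of moduli,

  `‖∑_{m∈S} ∑_{degenerate, ℓ₁n₁≠ℓ₂n₂} [⋯] c_m(n₁) conj c_m(n₂)‖ ≤ T' #𝓛 (2N' ‖γ‖²) (1 + 4 log(2N')/log L)`

where `T'` bounds `τ(w)` on `1 ≤ w ≤ 4LN'`, `𝓛 ⊆ {primes in (L,2L]}`, `L ≥ 2`, `N' ≥ 1/2`:

* `kfo_term_norm_le`, `kfo_sum_m_norm_le` — a term with modulus `m` vanishes unless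
  `m ∣ ℓ₁n₁ - ℓ₂n₂ ≠ 0`, so at most `τ(|ℓ₁n₁ - ℓ₂n₂|)` moduli contribute `≤ ‖γ_{n₁}‖ ‖γ_{n₂}‖` each;
* `kfo_deg_indicator_le` — `[degenerate] ≤ [ℓ₁=ℓ₂] + [ℓ₁∣n₁] + [ℓ₂∣n₁] + [ℓ₁∣n₂] + [ℓ₂∣n₂]`;
* `kfo_sum4_*` — the five separable four-fold sums: `#𝓛 (∑‖γ_n‖)²` and four times
  `#𝓛 (∑_n ‖γ_n‖ #{ℓ∈𝓛 : ℓ∣n}) (∑‖γ_n‖)`, with `#{ℓ ∈ 𝓛 : ℓ ∣ n} ≤ log n/log L`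
  (`DFI_card_primes_dvd_mul_log_le`) and `(∑_{n≤2N'} ‖γ_n‖)² ≤ 2N' ‖γ‖²`.

The phase is the section variable `e` with `he` as in `KloostermanFractionsDiagonal.lean`.

## References

* S. Bettin, V. Chandee, Adv. Math. 328 (2018) 1234–1262 (arXiv:1502.00769), §2, §3
  (eqn:diagonal), §4 (vae1), (dft), (2bd). [BettinChandee2018]
* W. Duke, J. Friedlander, H. Iwaniec, Invent. Math. 128 (1997) 23–43. [DukeFriedlanderIwaniec1997]
-/

noncomputable section

open Finset

namespace Literature.NumberTheory.LFunctions

section Phase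

variable (e : ℤ → ℕ → ℕ → ℂ)
  (he : ∀ (k : ℤ) (q m : ℕ), e k q m = Complex.exp (2 * Real.pi * Complex.I *
    ((k : ℂ) * ((((m : ZMod q)⁻¹).val : ℕ) : ℂ) / (q : ℂ))))

/-! ### One off-diagonal term: at most `τ(|ℓ₁n₁ - ℓ₂n₂|)` moduli `m` contribute -/

include he in
/-- The norm of one term of the orthogonality expansion is at most
`[m ∣ |ℓ₁n₁ - ℓ₂n₂|] ‖γ_{n₁}‖ ‖γ_{n₂}‖`. [folklore] -/
theorem kfo_term_norm_le (k : ℤ) (b : ℕ) (γ : ℕ → ℂ) (m ℓ₁ n₁ ℓ₂ n₂ : ℕ) :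
    ‖(if (ℓ₂ * n₂).Coprime m ∧ ((ℓ₁ * n₁ : ℕ) : ZMod m) = ((ℓ₂ * n₂ : ℕ) : ZMod m) then
        γ n₁ * e k (b * n₁) m * (starRingEnd ℂ) (γ n₂ * e k (b * n₂) m) else 0)‖ ≤
      if m ∣ Int.natAbs ((ℓ₁ * n₁ : ℤ) - ℓ₂ * n₂) then ‖γ n₁‖ * ‖γ n₂‖ else 0 := by
  by_cases hc : (ℓ₂ * n₂).Coprime m ∧ ((ℓ₁ * n₁ : ℕ) : ZMod m) = ((ℓ₂ * n₂ : ℕ) : ZMod m)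
  · rw [if_pos hc]
    have hdvd : m ∣ Int.natAbs ((ℓ₁ * n₁ : ℤ) - ℓ₂ * n₂) := by
      have h1 : (((ℓ₂ * n₂ : ℕ) : ℤ) : ZMod m) = (((ℓ₁ * n₁ : ℕ) : ℤ) : ZMod m) := by
        push_cast
        have := hc.2
        push_cast at this
        exact this.symm
      rw [ZMod.intCast_eq_intCast_iff_dvd_sub] at h1
      have h2 := Int.natCast_dvd.mp h1
      push_cast at h2
      exact h2
    rw [if_pos hdvd, norm_mul, norm_mul, map_mul, norm_mul, RCLike.norm_conj, RCLike.norm_conj,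
      kfd_norm_e e he, kfd_norm_e e he]
    simp
  · rw [if_neg hc, norm_zero]
    split_ifs <;> positivity

/-- At most `τ(w)` elements of any finite set of naturals divide `w ≠ 0`. [folklore] -/
theorem kfo_card_filter_dvd_le (S : Finset ℕ) {w : ℕ} (hw : w ≠ 0) :
    (S.filter (fun m => m ∣ w)).card ≤ w.divisors.card := by
  refine Finset.card_le_card fun m hm => ?_
  rw [Finset.mem_filter] at hm
  exact Nat.mem_divisors.mpr ⟨hm.2, hw⟩

include he in
/-- **The `m`-sum of one off-diagonal term, trivially**: for `ℓ₁n₁ ≠ ℓ₂n₂`,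
`∑_{m ∈ S} ‖term‖ ≤ τ(|ℓ₁n₁ - ℓ₂n₂|) ‖γ_{n₁}‖ ‖γ_{n₂}‖`. [folklore] -/
theorem kfo_sum_m_norm_le (k : ℤ) (b : ℕ) (γ : ℕ → ℂ) (S : Finset ℕ) {ℓ₁ n₁ ℓ₂ n₂ : ℕ}
    (hne : ℓ₁ * n₁ ≠ ℓ₂ * n₂) :
    ∑ m ∈ S, ‖(if (ℓ₂ * n₂).Coprime m ∧ ((ℓ₁ * n₁ : ℕ) : ZMod m) = ((ℓ₂ * n₂ : ℕ) : ZMod m)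
        then γ n₁ * e k (b * n₁) m * (starRingEnd ℂ) (γ n₂ * e k (b * n₂) m) else 0)‖ ≤
      ((Int.natAbs ((ℓ₁ * n₁ : ℤ) - ℓ₂ * n₂)).divisors.card : ℝ) * (‖γ n₁‖ * ‖γ n₂‖) := by
  have hw : Int.natAbs ((ℓ₁ * n₁ : ℤ) - ℓ₂ * n₂) ≠ 0 := by
    intro h
    rw [Int.natAbs_eq_zero, sub_eq_zero] at h
    exact hne (by exact_mod_cast h)
  calc ∑ m ∈ S, ‖(if (ℓ₂ * n₂).Coprime m ∧ ((ℓ₁ * n₁ : ℕ) : ZMod m) = ((ℓ₂ * n₂ : ℕ) : ZMod m)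
          then γ n₁ * e k (b * n₁) m * (starRingEnd ℂ) (γ n₂ * e k (b * n₂) m) else 0)‖
      ≤ ∑ m ∈ S, (if m ∣ Int.natAbs ((ℓ₁ * n₁ : ℤ) - ℓ₂ * n₂) then ‖γ n₁‖ * ‖γ n₂‖ else 0) :=
        Finset.sum_le_sum fun m _ => kfo_term_norm_le e he k b γ m ℓ₁ n₁ ℓ₂ n₂
    _ = ((S.filter (fun m => m ∣ Int.natAbs ((ℓ₁ * n₁ : ℤ) - ℓ₂ * n₂))).card : ℝ) *
          (‖γ n₁‖ * ‖γ n₂‖) := by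
        rw [← Finset.sum_filter, Finset.sum_const, nsmul_eq_mul]
    _ ≤ ((Int.natAbs ((ℓ₁ * n₁ : ℤ) - ℓ₂ * n₂)).divisors.card : ℝ) * (‖γ n₁‖ * ‖γ n₂‖) := by
        have := kfo_card_filter_dvd_le S hw
        have h0 : 0 ≤ ‖γ n₁‖ * ‖γ n₂‖ := by positivity
        exact mul_le_mul_of_nonneg_right (by exact_mod_cast this) h0


/-! ### Counting the degenerate tuples against the weights `‖γ_{n₁}‖ ‖γ_{n₂}‖` -/

/-- `∑_{ℓ ∈ 𝓛} [ℓ' = ℓ] = 1` for `ℓ' ∈ 𝓛`. [folklore] -/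
theorem kfo_sum_ite_eq_one (𝓛 : Finset ℕ) {ℓ' : ℕ} (h : ℓ' ∈ 𝓛) :
    ∑ ℓ ∈ 𝓛, (if ℓ' = ℓ then (1 : ℝ) else 0) = 1 := by
  rw [Finset.sum_ite_eq]
  rw [if_pos h]

/-- The weighted count of amplifier primes dividing `n`:
`∑_{n} ‖γ_n‖ #{ℓ ∈ 𝓛 : ℓ ∣ n} ≤ (log(2N')/log L) ∑_n ‖γ_n‖`. [folklore] -/
theorem kfo_sum_weight_omega_le {L : ℕ} (hL : 2 ≤ L) (𝓛 : Finset ℕ)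
    (h𝓛 : ∀ ℓ ∈ 𝓛, ℓ.Prime ∧ L < ℓ) {N' : ℝ} (hN' : 1 / 2 ≤ N') (g : ℕ → ℝ)
    (hg : ∀ n, 0 ≤ g n) :
    ∑ n ∈ Icc 1 ⌊2 * N'⌋₊, g n * ((𝓛.filter (fun ℓ => ℓ ∣ n)).card : ℝ) ≤
      Real.log (2 * N') / Real.log L * ∑ n ∈ Icc 1 ⌊2 * N'⌋₊, g n := by
  rw [Finset.mul_sum]
  refine Finset.sum_le_sum fun n hn => ?_
  have hn1 : 1 ≤ n := (Finset.mem_Icc.mp hn).1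
  have hn2 : (n : ℝ) ≤ 2 * N' := by
    calc (n : ℝ) ≤ ⌊2 * N'⌋₊ := by exact_mod_cast (Finset.mem_Icc.mp hn).2
      _ ≤ 2 * N' := Nat.floor_le (by linarith)
  have hLr : (1 : ℝ) ≤ (L : ℝ) := by exact_mod_cast (le_trans (by norm_num) hL : 1 ≤ L)
  have hlogL : 0 < Real.log L :=
    Real.log_pos (by exact_mod_cast (lt_of_lt_of_le (by norm_num) hL : 1 < L))
  have h := DFI_card_primes_dvd_mul_log_le (𝓛 := 𝓛) (L := (L : ℝ)) hLr
    (fun ℓ hℓ => ⟨(h𝓛 ℓ hℓ).1, by exact_mod_cast (h𝓛 ℓ hℓ).2⟩) hn1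
  have hcard : ((𝓛.filter (fun ℓ => ℓ ∣ n)).card : ℝ) ≤ Real.log (2 * N') / Real.log L := by
    rw [le_div_iff₀ hlogL]
    exact h.trans (Real.log_le_log (by exact_mod_cast hn1) hn2)
  calc g n * ((𝓛.filter (fun ℓ => ℓ ∣ n)).card : ℝ) ≤ g n * (Real.log (2 * N') / Real.log L) :=
        mul_le_mul_of_nonneg_left hcard (hg n)
    _ = Real.log (2 * N') / Real.log L * g n := by ring

/-- The indicator of a degenerate off-diagonal tuple is dominated by five simple indicators:
for `ℓ₁, ℓ₂` prime, `[ℓ₁ = ℓ₂ ∨ (n₁n₂, ℓ₁ℓ₂) > 1] ≤ [ℓ₁=ℓ₂] + [ℓ₁∣n₁] + [ℓ₂∣n₁] + [ℓ₁∣n₂] + [ℓ₂∣n₂]`.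
[folklore] -/
theorem kfo_deg_indicator_le {ℓ₁ ℓ₂ : ℕ} (hp₁ : ℓ₁.Prime) (hp₂ : ℓ₂.Prime) (n₁ n₂ : ℕ)
    {c : ℝ} (hc : 0 ≤ c) :
    (if ℓ₁ = ℓ₂ ∨ ¬ (n₁ * n₂).Coprime (ℓ₁ * ℓ₂) then c else 0) ≤
      c * ((if ℓ₁ = ℓ₂ then (1 : ℝ) else 0) + (if ℓ₁ ∣ n₁ then 1 else 0) +
        (if ℓ₂ ∣ n₁ then 1 else 0) + (if ℓ₁ ∣ n₂ then 1 else 0) + (if ℓ₂ ∣ n₂ then 1 else 0)) := by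
  by_cases h : ℓ₁ = ℓ₂ ∨ ¬ (n₁ * n₂).Coprime (ℓ₁ * ℓ₂)
  · rw [if_pos h]
    -- at least one of the five indicators is `1`
    have hone : (1 : ℝ) ≤ (if ℓ₁ = ℓ₂ then (1 : ℝ) else 0) + (if ℓ₁ ∣ n₁ then 1 else 0) +
        (if ℓ₂ ∣ n₁ then 1 else 0) + (if ℓ₁ ∣ n₂ then 1 else 0) + (if ℓ₂ ∣ n₂ then 1 else 0) := by
      rcases h with h | h
      · rw [if_pos h]
        have : (0 : ℝ) ≤ (if ℓ₁ ∣ n₁ then (1 : ℝ) else 0) + (if ℓ₂ ∣ n₁ then 1 else 0) +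
            (if ℓ₁ ∣ n₂ then 1 else 0) + (if ℓ₂ ∣ n₂ then 1 else 0) := by positivity
        linarith
      · -- a prime factor of `(n₁n₂, ℓ₁ℓ₂)` is `ℓ₁` or `ℓ₂` and divides `n₁` or `n₂`
        rw [Nat.Coprime, ← ne_eq] at h
        obtain ⟨p, hp, hpd⟩ := Nat.ne_one_iff_exists_prime_dvd.mp h
        have hp1 : p ∣ n₁ * n₂ := hpd.trans (Nat.gcd_dvd_left _ _)
        have hp2 : p ∣ ℓ₁ * ℓ₂ := hpd.trans (Nat.gcd_dvd_right _ _)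
        have hpℓ : p = ℓ₁ ∨ p = ℓ₂ := by
          rcases hp.dvd_mul.mp hp2 with h2 | h2
          · exact Or.inl ((Nat.prime_dvd_prime_iff_eq hp hp₁).mp h2)
          · exact Or.inr ((Nat.prime_dvd_prime_iff_eq hp hp₂).mp h2)
        have hpn : p ∣ n₁ ∨ p ∣ n₂ := hp.dvd_mul.mp hp1
        rcases hpℓ with rfl | rfl <;> rcases hpn with h3 | h3
        · rw [if_pos h3]
          have : (0 : ℝ) ≤ (if p = ℓ₂ then (1 : ℝ) else 0) + (if ℓ₂ ∣ n₁ then (1 : ℝ) else 0) +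
              (if p ∣ n₂ then (1 : ℝ) else 0) + (if ℓ₂ ∣ n₂ then (1 : ℝ) else 0) := by
            positivity
          linarith
        · rw [if_pos h3]
          have : (0 : ℝ) ≤ (if p = ℓ₂ then (1 : ℝ) else 0) + (if p ∣ n₁ then (1 : ℝ) else 0) +
              (if ℓ₂ ∣ n₁ then (1 : ℝ) else 0) + (if ℓ₂ ∣ n₂ then (1 : ℝ) else 0) := by
            positivity
          linarith
        · rw [if_pos h3]
          have : (0 : ℝ) ≤ (if ℓ₁ = p then (1 : ℝ) else 0) + (if ℓ₁ ∣ n₁ then (1 : ℝ) else 0) +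
              (if ℓ₁ ∣ n₂ then (1 : ℝ) else 0) + (if p ∣ n₂ then (1 : ℝ) else 0) := by
            positivity
          linarith
        · rw [if_pos h3]
          have : (0 : ℝ) ≤ (if ℓ₁ = p then (1 : ℝ) else 0) + (if ℓ₁ ∣ n₁ then (1 : ℝ) else 0) +
              (if p ∣ n₁ then (1 : ℝ) else 0) + (if ℓ₁ ∣ n₂ then (1 : ℝ) else 0) := by
            positivity
          linarith
    nlinarith [mul_nonneg hc (sub_nonneg.mpr hone)]
  · rw [if_neg h]
    positivity

/-! ### Four-fold sums of separable indicators -/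

/-- Pulling a constant out of a four-fold sum. [folklore] -/
theorem kfo_sum4_const_mul (𝓛 I : Finset ℕ) (c : ℝ) (H : ℕ → ℕ → ℕ → ℕ → ℝ) :
    ∑ ℓ₁ ∈ 𝓛, ∑ n₁ ∈ I, ∑ ℓ₂ ∈ 𝓛, ∑ n₂ ∈ I, c * H ℓ₁ n₁ ℓ₂ n₂ =
      c * ∑ ℓ₁ ∈ 𝓛, ∑ n₁ ∈ I, ∑ ℓ₂ ∈ 𝓛, ∑ n₂ ∈ I, H ℓ₁ n₁ ℓ₂ n₂ := by
  rw [Finset.mul_sum]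
  refine Finset.sum_congr rfl fun ℓ₁ _ => ?_
  rw [Finset.mul_sum]
  refine Finset.sum_congr rfl fun n₁ _ => ?_
  rw [Finset.mul_sum]
  refine Finset.sum_congr rfl fun ℓ₂ _ => ?_
  rw [Finset.mul_sum]

/-- `∑∑∑∑ g₁ g₂ F(ℓ₁,n₁) = (∑∑ g₁ F) · (#𝓛 · A)`. [folklore] -/
theorem kfo_sum4_dep12 (𝓛 I : Finset ℕ) (g : ℕ → ℝ) (F : ℕ → ℕ → ℝ) :
    ∑ ℓ₁ ∈ 𝓛, ∑ n₁ ∈ I, ∑ _ℓ₂ ∈ 𝓛, ∑ n₂ ∈ I, g n₁ * g n₂ * F ℓ₁ n₁ =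
      (∑ ℓ₁ ∈ 𝓛, ∑ n₁ ∈ I, g n₁ * F ℓ₁ n₁) * (𝓛.card * ∑ n ∈ I, g n) := by
  calc ∑ ℓ₁ ∈ 𝓛, ∑ n₁ ∈ I, ∑ _ℓ₂ ∈ 𝓛, ∑ n₂ ∈ I, g n₁ * g n₂ * F ℓ₁ n₁
      = ∑ ℓ₁ ∈ 𝓛, ∑ n₁ ∈ I, (g n₁ * F ℓ₁ n₁) * ∑ _ℓ₂ ∈ 𝓛, ∑ n₂ ∈ I, g n₂ := by
        refine Finset.sum_congr rfl fun ℓ₁ _ => Finset.sum_congr rfl fun n₁ _ => ?_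
        rw [Finset.mul_sum]
        refine Finset.sum_congr rfl fun ℓ₂ _ => ?_
        rw [Finset.mul_sum]
        exact Finset.sum_congr rfl fun n₂ _ => by ring
    _ = (∑ ℓ₁ ∈ 𝓛, ∑ n₁ ∈ I, g n₁ * F ℓ₁ n₁) * ∑ _ℓ₂ ∈ 𝓛, ∑ n₂ ∈ I, g n₂ := by
        rw [Finset.sum_mul]
        refine Finset.sum_congr rfl fun ℓ₁ _ => ?_
        rw [Finset.sum_mul]
    _ = (∑ ℓ₁ ∈ 𝓛, ∑ n₁ ∈ I, g n₁ * F ℓ₁ n₁) * (𝓛.card * ∑ n ∈ I, g n) := by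
        rw [Finset.sum_const, nsmul_eq_mul]

/-- `∑∑∑∑ g₁ g₂ F(ℓ₂,n₁) = #𝓛 · ((∑_{n₁} g₁ ∑_{ℓ₂} F(ℓ₂,n₁)) · A)`. [folklore] -/
theorem kfo_sum4_dep32 (𝓛 I : Finset ℕ) (g : ℕ → ℝ) (F : ℕ → ℕ → ℝ) :
    ∑ _ℓ₁ ∈ 𝓛, ∑ n₁ ∈ I, ∑ ℓ₂ ∈ 𝓛, ∑ n₂ ∈ I, g n₁ * g n₂ * F ℓ₂ n₁ =
      𝓛.card * ((∑ n₁ ∈ I, g n₁ * ∑ ℓ₂ ∈ 𝓛, F ℓ₂ n₁) * ∑ n ∈ I, g n) := by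
  have h1 : ∀ n₁, ∑ ℓ₂ ∈ 𝓛, ∑ n₂ ∈ I, g n₁ * g n₂ * F ℓ₂ n₁ =
      (g n₁ * ∑ ℓ₂ ∈ 𝓛, F ℓ₂ n₁) * ∑ n ∈ I, g n := by
    intro n₁
    rw [Finset.mul_sum 𝓛 (fun ℓ₂ => F ℓ₂ n₁) (g n₁), Finset.sum_mul]
    refine Finset.sum_congr rfl fun ℓ₂ _ => ?_
    rw [Finset.mul_sum]
    exact Finset.sum_congr rfl fun n₂ _ => by ring
  have h2 : ∀ _ℓ₁ ∈ 𝓛, ∑ n₁ ∈ I, ∑ ℓ₂ ∈ 𝓛, ∑ n₂ ∈ I, g n₁ * g n₂ * F ℓ₂ n₁ =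
      (∑ n₁ ∈ I, g n₁ * ∑ ℓ₂ ∈ 𝓛, F ℓ₂ n₁) * ∑ n ∈ I, g n := by
    intro _ _
    rw [Finset.sum_mul]
    exact Finset.sum_congr rfl fun n₁ _ => h1 n₁
  rw [Finset.sum_congr rfl h2, Finset.sum_const, nsmul_eq_mul]

/-- `∑∑∑∑ g₁ g₂ F(ℓ₁,n₂) = A · (#𝓛 · ∑_{ℓ₁} ∑_{n₂} g₂ F(ℓ₁,n₂))`. [folklore] -/
theorem kfo_sum4_dep14 (𝓛 I : Finset ℕ) (g : ℕ → ℝ) (F : ℕ → ℕ → ℝ) :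
    ∑ ℓ₁ ∈ 𝓛, ∑ n₁ ∈ I, ∑ _ℓ₂ ∈ 𝓛, ∑ n₂ ∈ I, g n₁ * g n₂ * F ℓ₁ n₂ =
      (∑ n ∈ I, g n) * (𝓛.card * ∑ ℓ₁ ∈ 𝓛, ∑ n₂ ∈ I, g n₂ * F ℓ₁ n₂) := by
  have h1 : ∀ ℓ₁ n₁, ∑ _ℓ₂ ∈ 𝓛, ∑ n₂ ∈ I, g n₁ * g n₂ * F ℓ₁ n₂ =
      g n₁ * (𝓛.card * ∑ n₂ ∈ I, g n₂ * F ℓ₁ n₂) := by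
    intro ℓ₁ n₁
    have : ∑ n₂ ∈ I, g n₁ * g n₂ * F ℓ₁ n₂ = g n₁ * ∑ n₂ ∈ I, g n₂ * F ℓ₁ n₂ := by
      rw [Finset.mul_sum]
      exact Finset.sum_congr rfl fun n₂ _ => by ring
    rw [Finset.sum_const, nsmul_eq_mul, this]
    ring
  have h2 : ∀ ℓ₁ ∈ 𝓛, ∑ n₁ ∈ I, ∑ _ℓ₂ ∈ 𝓛, ∑ n₂ ∈ I, g n₁ * g n₂ * F ℓ₁ n₂ =
      (∑ n ∈ I, g n) * (𝓛.card * ∑ n₂ ∈ I, g n₂ * F ℓ₁ n₂) := by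
    intro ℓ₁ _
    rw [Finset.sum_mul]
    exact Finset.sum_congr rfl fun n₁ _ => h1 ℓ₁ n₁
  rw [Finset.sum_congr rfl h2, ← Finset.mul_sum, ← Finset.mul_sum]

/-- `∑∑∑∑ g₁ g₂ F(ℓ₂,n₂) = (#𝓛 · A) · ∑_{ℓ₂} ∑_{n₂} g₂ F(ℓ₂,n₂)`. [folklore] -/
theorem kfo_sum4_dep34 (𝓛 I : Finset ℕ) (g : ℕ → ℝ) (F : ℕ → ℕ → ℝ) :
    ∑ _ℓ₁ ∈ 𝓛, ∑ n₁ ∈ I, ∑ ℓ₂ ∈ 𝓛, ∑ n₂ ∈ I, g n₁ * g n₂ * F ℓ₂ n₂ =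
      (𝓛.card * ∑ n ∈ I, g n) * ∑ ℓ₂ ∈ 𝓛, ∑ n₂ ∈ I, g n₂ * F ℓ₂ n₂ := by
  have h1 : ∀ n₁, ∑ ℓ₂ ∈ 𝓛, ∑ n₂ ∈ I, g n₁ * g n₂ * F ℓ₂ n₂ =
      g n₁ * ∑ ℓ₂ ∈ 𝓛, ∑ n₂ ∈ I, g n₂ * F ℓ₂ n₂ := by
    intro n₁
    rw [Finset.mul_sum]
    refine Finset.sum_congr rfl fun ℓ₂ _ => ?_
    rw [Finset.mul_sum]
    exact Finset.sum_congr rfl fun n₂ _ => by ring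
  have h2 : ∀ _ℓ₁ ∈ 𝓛, ∑ n₁ ∈ I, ∑ ℓ₂ ∈ 𝓛, ∑ n₂ ∈ I, g n₁ * g n₂ * F ℓ₂ n₂ =
      (∑ n ∈ I, g n) * ∑ ℓ₂ ∈ 𝓛, ∑ n₂ ∈ I, g n₂ * F ℓ₂ n₂ := by
    intro _ _
    rw [Finset.sum_mul]
    exact Finset.sum_congr rfl fun n₁ _ => h1 n₁
  rw [Finset.sum_congr rfl h2, Finset.sum_const, nsmul_eq_mul]
  ring

/-- `∑∑∑∑ g₁ g₂ [ℓ₁ = ℓ₂] = #𝓛 · A²`. [folklore] -/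
theorem kfo_sum4_eq (𝓛 I : Finset ℕ) (g : ℕ → ℝ) :
    ∑ ℓ₁ ∈ 𝓛, ∑ n₁ ∈ I, ∑ ℓ₂ ∈ 𝓛, ∑ n₂ ∈ I, g n₁ * g n₂ * (if ℓ₁ = ℓ₂ then (1 : ℝ) else 0) =
      𝓛.card * ((∑ n ∈ I, g n) * ∑ n ∈ I, g n) := by
  have h1 : ∀ ℓ₁ ∈ 𝓛, ∀ n₁,
      ∑ ℓ₂ ∈ 𝓛, ∑ n₂ ∈ I, g n₁ * g n₂ * (if ℓ₁ = ℓ₂ then (1 : ℝ) else 0) =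
        g n₁ * ∑ n ∈ I, g n := by
    intro ℓ₁ hℓ₁ n₁
    have : ∀ ℓ₂ ∈ 𝓛, ∑ n₂ ∈ I, g n₁ * g n₂ * (if ℓ₁ = ℓ₂ then (1 : ℝ) else 0) =
        (if ℓ₁ = ℓ₂ then (1 : ℝ) else 0) * (g n₁ * ∑ n ∈ I, g n) := by
      intro ℓ₂ _
      rw [Finset.mul_sum, Finset.mul_sum]
      exact Finset.sum_congr rfl fun n₂ _ => by ring
    rw [Finset.sum_congr rfl this, ← Finset.sum_mul, kfo_sum_ite_eq_one 𝓛 hℓ₁, one_mul]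
  have h2 : ∀ ℓ₁ ∈ 𝓛, ∑ n₁ ∈ I, ∑ ℓ₂ ∈ 𝓛, ∑ n₂ ∈ I,
      g n₁ * g n₂ * (if ℓ₁ = ℓ₂ then (1 : ℝ) else 0) = (∑ n ∈ I, g n) * ∑ n ∈ I, g n := by
    intro ℓ₁ hℓ₁
    rw [Finset.sum_mul]
    exact Finset.sum_congr rfl fun n₁ _ => h1 ℓ₁ hℓ₁ n₁
  rw [Finset.sum_congr rfl h2, Finset.sum_const, nsmul_eq_mul]

/-- Distributing the five indicators. [folklore] -/
theorem kfo_sum4_five (𝓛 I : Finset ℕ) (g : ℕ → ℝ) (J₁ J₂ J₃ J₄ J₅ : ℕ → ℕ → ℕ → ℕ → ℝ) :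
    ∑ ℓ₁ ∈ 𝓛, ∑ n₁ ∈ I, ∑ ℓ₂ ∈ 𝓛, ∑ n₂ ∈ I, g n₁ * g n₂ *
        (J₁ ℓ₁ n₁ ℓ₂ n₂ + J₂ ℓ₁ n₁ ℓ₂ n₂ + J₃ ℓ₁ n₁ ℓ₂ n₂ + J₄ ℓ₁ n₁ ℓ₂ n₂ + J₅ ℓ₁ n₁ ℓ₂ n₂) =
      (∑ ℓ₁ ∈ 𝓛, ∑ n₁ ∈ I, ∑ ℓ₂ ∈ 𝓛, ∑ n₂ ∈ I, g n₁ * g n₂ * J₁ ℓ₁ n₁ ℓ₂ n₂) +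
      (∑ ℓ₁ ∈ 𝓛, ∑ n₁ ∈ I, ∑ ℓ₂ ∈ 𝓛, ∑ n₂ ∈ I, g n₁ * g n₂ * J₂ ℓ₁ n₁ ℓ₂ n₂) +
      (∑ ℓ₁ ∈ 𝓛, ∑ n₁ ∈ I, ∑ ℓ₂ ∈ 𝓛, ∑ n₂ ∈ I, g n₁ * g n₂ * J₃ ℓ₁ n₁ ℓ₂ n₂) +
      (∑ ℓ₁ ∈ 𝓛, ∑ n₁ ∈ I, ∑ ℓ₂ ∈ 𝓛, ∑ n₂ ∈ I, g n₁ * g n₂ * J₄ ℓ₁ n₁ ℓ₂ n₂) +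
      (∑ ℓ₁ ∈ 𝓛, ∑ n₁ ∈ I, ∑ ℓ₂ ∈ 𝓛, ∑ n₂ ∈ I, g n₁ * g n₂ * J₅ ℓ₁ n₁ ℓ₂ n₂) := by
  simp only [mul_add, Finset.sum_add_distrib]

include he in
/-- **The degenerate off-diagonal tuples, trivially.**  For any finite set `S` of moduli, any
`k, b, γ`, and `𝓛` a set of primes in `(L, 2L]` (`L ≥ 2`), the part of
`∑_{m∈S} ∑_{ℓ₁,ℓ₂∈𝓛, n₁,n₂≤2N', ℓ₁n₁≠ℓ₂n₂} [(ℓ₂n₂,m)=1, ℓ₁n₁≡ℓ₂n₂ (m)] c_m(n₁) conj c_m(n₂)`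
(`c_m(n) = γ_n e(k m̄/(bn))`) coming from the DEGENERATE tuples — `ℓ₁ = ℓ₂`, or
`(n₁n₂, ℓ₁ℓ₂) > 1` — has norm at most
`T' #𝓛 (2N' ‖γ‖²) (1 + 4 log(2N')/log L)`, where `T'` bounds `τ(w)` for `1 ≤ w ≤ 4LN'`:
each tuple has `≤ τ(|ℓ₁n₁ - ℓ₂n₂|)` moduli `m ∣ ℓ₁n₁ - ℓ₂n₂`, the tuples with `ℓ₁ = ℓ₂` weigh
`#𝓛 (∑‖γ_n‖)²`, and those with `ℓ ∣ n` weigh `≤ 4 #𝓛 (∑_n ‖γ_n‖ #{ℓ∈𝓛 : ℓ∣n}) (∑‖γ_n‖)` with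
`#{ℓ ∈ 𝓛 : ℓ ∣ n} ≤ log n/log L`.  (In Bettin–Chandee §4 these tuples are carried through the
Kloosterman-sum analysis via the parameters `𝔭ᵢ, 𝔮ᵢ, η`; for `A = 1` the trivial bound is of
the same order `L N'^{1+ε} ‖γ‖²` as the "longer diagonal" kept there, cf. (eqn:diagonal).)
[cite: BettinChandee2018, §4 (structure); folklore (bound)] -/
theorem kfo_deg_bound (k : ℤ) (b : ℕ) {L : ℕ} (hL : 2 ≤ L) (𝓛 : Finset ℕ)
    (h𝓛 : ∀ ℓ ∈ 𝓛, ℓ.Prime ∧ L < ℓ ∧ ℓ ≤ 2 * L) {N' T' : ℝ} (hN' : 1 / 2 ≤ N') (γ : ℕ → ℂ)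
    (hT' : ∀ w : ℕ, 1 ≤ w → (w : ℝ) ≤ 4 * L * N' → (w.divisors.card : ℝ) ≤ T')
    (S : Finset ℕ) :
    ‖∑ m ∈ S, ∑ ℓ₁ ∈ 𝓛, ∑ n₁ ∈ Icc 1 ⌊2 * N'⌋₊, ∑ ℓ₂ ∈ 𝓛, ∑ n₂ ∈ Icc 1 ⌊2 * N'⌋₊,
        (if ℓ₁ * n₁ = ℓ₂ * n₂ then 0 else
          if (ℓ₁ = ℓ₂ ∨ ¬ (n₁ * n₂).Coprime (ℓ₁ * ℓ₂)) then
            (if (ℓ₂ * n₂).Coprime m ∧ ((ℓ₁ * n₁ : ℕ) : ZMod m) = ((ℓ₂ * n₂ : ℕ) : ZMod m) then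
              γ n₁ * e k (b * n₁) m * (starRingEnd ℂ) (γ n₂ * e k (b * n₂) m) else 0)
          else 0)‖ ≤
      T' * 𝓛.card * ((2 * N') * ∑ n ∈ Icc 1 ⌊2 * N'⌋₊, ‖γ n‖ ^ 2) *
        (1 + 4 * (Real.log (2 * N') / Real.log L)) := by
  set I := Icc 1 ⌊2 * N'⌋₊ with hI
  set g : ℕ → ℝ := fun n => ‖γ n‖ with hg
  set A : ℝ := ∑ n ∈ I, g n with hA
  set R : ℝ := Real.log (2 * N') / Real.log L with hR
  have hg0 : ∀ n, 0 ≤ g n := fun n => norm_nonneg _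
  have hA0 : 0 ≤ A := Finset.sum_nonneg fun n _ => hg0 n
  have hL0 : (0 : ℝ) < L := by exact_mod_cast (lt_of_lt_of_le (by norm_num) hL : 0 < L)
  -- `T' ≥ 1` (take `w = 1`)
  have hT'1 : (1 : ℝ) ≤ T' := by
    have h4 : ((1 : ℕ) : ℝ) ≤ 4 * L * N' := by
      have : (2 : ℝ) ≤ L := by exact_mod_cast hL
      push_cast; nlinarith
    have := hT' 1 le_rfl h4
    simpa using this
  have hT'0 : 0 ≤ T' := le_trans zero_le_one hT'1
  rw [kfd_sum_comm5]
  -- Step 1: pointwise bound by `T' g₁ g₂ J`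
  have hpt : ∀ ℓ₁ ∈ 𝓛, ∀ n₁ ∈ I, ∀ ℓ₂ ∈ 𝓛, ∀ n₂ ∈ I,
      ‖∑ m ∈ S, (if ℓ₁ * n₁ = ℓ₂ * n₂ then 0 else
          if (ℓ₁ = ℓ₂ ∨ ¬ (n₁ * n₂).Coprime (ℓ₁ * ℓ₂)) then
            (if (ℓ₂ * n₂).Coprime m ∧ ((ℓ₁ * n₁ : ℕ) : ZMod m) = ((ℓ₂ * n₂ : ℕ) : ZMod m) then
              γ n₁ * e k (b * n₁) m * (starRingEnd ℂ) (γ n₂ * e k (b * n₂) m) else 0)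
          else 0)‖ ≤
        T' * (g n₁ * g n₂) * ((if ℓ₁ = ℓ₂ then (1 : ℝ) else 0) + (if ℓ₁ ∣ n₁ then 1 else 0) +
          (if ℓ₂ ∣ n₁ then 1 else 0) + (if ℓ₁ ∣ n₂ then 1 else 0) +
          (if ℓ₂ ∣ n₂ then 1 else 0)) := by
    intro ℓ₁ hℓ₁ n₁ hn₁ ℓ₂ hℓ₂ n₂ hn₂
    obtain ⟨hp₁, _, hℓ₁L⟩ := h𝓛 ℓ₁ hℓ₁
    obtain ⟨hp₂, _, hℓ₂L⟩ := h𝓛 ℓ₂ hℓ₂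
    have hc0 : 0 ≤ T' * (g n₁ * g n₂) := by positivity
    refine le_trans ?_ (kfo_deg_indicator_le hp₁ hp₂ n₁ n₂ hc0)
    rw [Finset.sum_ite_irrel, Finset.sum_const_zero, Finset.sum_ite_irrel, Finset.sum_const_zero]
    by_cases hdiag : ℓ₁ * n₁ = ℓ₂ * n₂
    · rw [if_pos hdiag, norm_zero]
      split_ifs <;> positivity
    rw [if_neg hdiag]
    by_cases hdeg : ℓ₁ = ℓ₂ ∨ ¬ (n₁ * n₂).Coprime (ℓ₁ * ℓ₂)
    · rw [if_pos hdeg, if_pos hdeg]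
      refine (norm_sum_le _ _).trans ((kfo_sum_m_norm_le e he k b γ S hdiag).trans ?_)
      refine mul_le_mul_of_nonneg_right (hT' _ ?_ ?_) (by positivity)
      · refine Nat.pos_of_ne_zero fun h => hdiag ?_
        rw [Int.natAbs_eq_zero, sub_eq_zero] at h
        exact_mod_cast h
      · -- `|ℓ₁n₁ - ℓ₂n₂| ≤ max ≤ 2L · 2N'`
        have hn₁' : (n₁ : ℝ) ≤ 2 * N' := by
          calc (n₁ : ℝ) ≤ ⌊2 * N'⌋₊ := by exact_mod_cast (Finset.mem_Icc.mp hn₁).2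
            _ ≤ 2 * N' := Nat.floor_le (by linarith)
        have hn₂' : (n₂ : ℝ) ≤ 2 * N' := by
          calc (n₂ : ℝ) ≤ ⌊2 * N'⌋₊ := by exact_mod_cast (Finset.mem_Icc.mp hn₂).2
            _ ≤ 2 * N' := Nat.floor_le (by linarith)
        have h1 : ((ℓ₁ * n₁ : ℕ) : ℝ) ≤ 4 * L * N' := by
          have : (ℓ₁ : ℝ) ≤ 2 * L := by exact_mod_cast hℓ₁L
          push_cast; nlinarith [hg0 0, Nat.cast_nonneg (α := ℝ) n₁, Nat.cast_nonneg (α := ℝ) ℓ₁]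
        have h2 : ((ℓ₂ * n₂ : ℕ) : ℝ) ≤ 4 * L * N' := by
          have : (ℓ₂ : ℝ) ≤ 2 * L := by exact_mod_cast hℓ₂L
          push_cast; nlinarith [Nat.cast_nonneg (α := ℝ) n₂, Nat.cast_nonneg (α := ℝ) ℓ₂]
        have hab : Int.natAbs ((ℓ₁ * n₁ : ℤ) - ℓ₂ * n₂) ≤ max (ℓ₁ * n₁) (ℓ₂ * n₂) := by omega
        calc ((Int.natAbs ((ℓ₁ * n₁ : ℤ) - ℓ₂ * n₂) : ℕ) : ℝ) ≤ ((max (ℓ₁ * n₁) (ℓ₂ * n₂) : ℕ) : ℝ) := by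
              exact_mod_cast hab
          _ ≤ 4 * L * N' := by
              rcases le_total (ℓ₁ * n₁) (ℓ₂ * n₂) with h | h
              · rw [max_eq_right h]; exact h2
              · rw [max_eq_left h]; exact h1
    · rw [if_neg hdeg, if_neg hdeg, norm_zero]
  -- Step 2: sum the majorant: `∑∑∑∑ T' g₁ g₂ J = T' (#𝓛 A² + 4 #𝓛 A · B-type sums)`
  set F₂ : ℕ → ℕ → ℝ := fun ℓ n => if ℓ ∣ n then (1 : ℝ) else 0 with hF₂
  have hΩ : ∀ n ∈ I, ∑ ℓ ∈ 𝓛, F₂ ℓ n = ((𝓛.filter (fun ℓ => ℓ ∣ n)).card : ℝ) := by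
    intro n _
    simp only [hF₂]
    rw [← Finset.sum_filter, Finset.sum_const, nsmul_eq_mul, mul_one]
  have h𝓛' : ∀ ℓ ∈ 𝓛, ℓ.Prime ∧ L < ℓ := fun ℓ hℓ => ⟨(h𝓛 ℓ hℓ).1, (h𝓛 ℓ hℓ).2.1⟩
  have hBle : ∑ n ∈ I, g n * ((𝓛.filter (fun ℓ => ℓ ∣ n)).card : ℝ) ≤ R * A :=
    kfo_sum_weight_omega_le hL 𝓛 h𝓛' hN' g hg0
  -- the four divisor-weighted double sums are all `≤ R A`
  have hS12 : ∑ ℓ₁ ∈ 𝓛, ∑ n₁ ∈ I, g n₁ * F₂ ℓ₁ n₁ ≤ R * A := by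
    rw [Finset.sum_comm]
    have : ∀ n ∈ I, ∑ ℓ ∈ 𝓛, g n * F₂ ℓ n = g n * ((𝓛.filter (fun ℓ => ℓ ∣ n)).card : ℝ) := by
      intro n hn; rw [← Finset.mul_sum, hΩ n hn]
    rw [Finset.sum_congr rfl this]
    exact hBle
  have hS32 : ∑ n₁ ∈ I, g n₁ * ∑ ℓ₂ ∈ 𝓛, F₂ ℓ₂ n₁ ≤ R * A := by
    rw [Finset.sum_congr rfl fun n hn => by rw [hΩ n hn]]
    exact hBle
  have hRA : 0 ≤ R * A := le_trans (Finset.sum_nonneg fun n _ => by positivity) hBle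
  -- `A² ≤ 2N' ‖γ‖²`
  have hA2 : A * A ≤ (2 * N') * ∑ n ∈ I, ‖γ n‖ ^ 2 := by
    have h1 : (∑ n ∈ I, g n) ^ 2 ≤ I.card * ∑ n ∈ I, g n ^ 2 := sq_sum_le_card_mul_sum_sq
    have h2 : (I.card : ℝ) ≤ 2 * N' := by
      rw [hI, Nat.card_Icc]
      have : ((⌊2 * N'⌋₊ + 1 - 1 : ℕ) : ℝ) = ⌊2 * N'⌋₊ := by simp
      rw [this]
      exact Nat.floor_le (by linarith)
    have h3 : 0 ≤ ∑ n ∈ I, g n ^ 2 := Finset.sum_nonneg fun n _ => by positivity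
    calc A * A = (∑ n ∈ I, g n) ^ 2 := by rw [hA]; ring
      _ ≤ I.card * ∑ n ∈ I, g n ^ 2 := h1
      _ ≤ (2 * N') * ∑ n ∈ I, ‖γ n‖ ^ 2 := by
          simp only [hg]; exact mul_le_mul_of_nonneg_right h2 h3
  have hR0 : 0 ≤ R := by
    rw [hR]
    refine div_nonneg (Real.log_nonneg (by linarith)) (Real.log_nonneg ?_)
    exact_mod_cast (le_trans (by norm_num) hL : 1 ≤ L)
  -- assemble
  refine (norm_sum_le _ _).trans ?_
  refine (Finset.sum_le_sum fun ℓ₁ hℓ₁ => (norm_sum_le _ _).trans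
    (Finset.sum_le_sum fun n₁ hn₁ => (norm_sum_le _ _).trans
      (Finset.sum_le_sum fun ℓ₂ hℓ₂ => (norm_sum_le _ _).trans
        (Finset.sum_le_sum fun n₂ hn₂ => hpt ℓ₁ hℓ₁ n₁ hn₁ ℓ₂ hℓ₂ n₂ hn₂)))).trans ?_
  -- rewrite the majorant as `T' * (g₁ g₂ (J₁ + ⋯ + J₅))` and evaluate
  have hmaj : ∀ ℓ₁ n₁ ℓ₂ n₂, T' * (g n₁ * g n₂) *
      ((if ℓ₁ = ℓ₂ then (1 : ℝ) else 0) + (if ℓ₁ ∣ n₁ then 1 else 0) +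
        (if ℓ₂ ∣ n₁ then 1 else 0) + (if ℓ₁ ∣ n₂ then 1 else 0) + (if ℓ₂ ∣ n₂ then 1 else 0)) =
      T' * (g n₁ * g n₂ * ((if ℓ₁ = ℓ₂ then (1 : ℝ) else 0) + F₂ ℓ₁ n₁ + F₂ ℓ₂ n₁ + F₂ ℓ₁ n₂ +
        F₂ ℓ₂ n₂)) := by
    intro ℓ₁ n₁ ℓ₂ n₂; simp only [hF₂]; ring
  simp_rw [hmaj]
  rw [kfo_sum4_const_mul, kfo_sum4_five, kfo_sum4_eq, kfo_sum4_dep12, kfo_sum4_dep32,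
    kfo_sum4_dep14, kfo_sum4_dep34]
  have hcard : (0 : ℝ) ≤ 𝓛.card := Nat.cast_nonneg _
  have hS14 : ∑ ℓ₁ ∈ 𝓛, ∑ n₂ ∈ I, g n₂ * F₂ ℓ₁ n₂ ≤ R * A := hS12
  calc T' * (𝓛.card * (A * A) + (∑ ℓ₁ ∈ 𝓛, ∑ n₁ ∈ I, g n₁ * F₂ ℓ₁ n₁) * (𝓛.card * A) +
        𝓛.card * ((∑ n₁ ∈ I, g n₁ * ∑ ℓ₂ ∈ 𝓛, F₂ ℓ₂ n₁) * A) +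
        A * (𝓛.card * ∑ ℓ₁ ∈ 𝓛, ∑ n₂ ∈ I, g n₂ * F₂ ℓ₁ n₂) +
        (𝓛.card * A) * ∑ ℓ₂ ∈ 𝓛, ∑ n₂ ∈ I, g n₂ * F₂ ℓ₂ n₂)
      ≤ T' * (𝓛.card * (A * A) + (R * A) * (𝓛.card * A) + 𝓛.card * ((R * A) * A) +
          A * (𝓛.card * (R * A)) + (𝓛.card * A) * (R * A)) := by
        gcongr
    _ = T' * 𝓛.card * (A * A) * (1 + 4 * R) := by ring
    _ ≤ T' * 𝓛.card * ((2 * N') * ∑ n ∈ I, ‖γ n‖ ^ 2) * (1 + 4 * R) := by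
        have h14 : 0 ≤ 1 + 4 * R := by linarith
        gcongr

end Phase

end Literature.NumberTheory.LFunctions

end
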